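import Summits.ResolutionOfSingularities.ResolutionOfSingularities.Theorems.EquisingularLiftEquisingularLiftNatNoseChart
import Summits.ResolutionOfSingularities.ResolutionOfSingularities.Theorems.EquisingularLiftEquisingularLiftNatStrictTransformComap
import HarnessLib

/-!
# [OURS · L1 W4.5(b) · EL♮(3) · door ν4, D7 brick HNODE, core P6] THE NOSE STALK THEOREM and (F⁺5ⁿ) «the special fibre of the
# strict transform of a NOSE is the strict transform of its special fibre»

res-L1-w45b-stub-2 g17 (HNODE pen). `--supports stmt-ResolutionOfSingularities-20148 --as helper`, no claim, counted 0. OURS; NOT a statement of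
[Hironaka2017]; AI-written, weaker than expert review. EL♮(3) is NOT proved here; char-p resolution is NOT proved anywhere in this tree. DEF-FREE.

The NOSE analogue of res-type-100's stalk theorem `exists_stalk_strictTransformIdeal_sup_comap` (✓ …NatCarrierDeltaStalks, principal `K_p = (Φ(c))`)
and of (F⁺5) `comap_strictTransformIdeal_eq_of_model` (✓ …NatStrictTransformComap): here `K_p = (c_{i₀}, Φ₂(c) + Ψ₃(c))` is the NOSE MODEL —
a host equation `c_{i₀}` of the centre's frame and a node `Φ₂(c) + Ψ₃(c)` (`Φ₂` a quadratic form whose reduced dehomogenisations avoid `T_{i₀}`,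
`Ψ₃` a cubic form); the ring core is ✓ `NoseChart.iSup_colon_nose_eq_span_localization` (…NatNoseChart, this seat).

* `exists_stalk_strictTransformIdeal_nose` / `…_of_eq` — at a point `x'` of the blow-up over `p ∈ supp J`, on a chart `j` with chart map `χ`:
  `E_{x'} = (χ(c_j/1))` and **`St_τ(K)_{x'} = (χ(c_{i₀}/c_j), χ(Φ₂(c/c_j) + (c_j/1)·Ψ₃(c/c_j)))`**;
* ★ `comap_strictTransformIdeal_eq_of_model_nose` — (F⁺5ⁿ): in the model square (`τ = Bl_J`, `υ = Bl_x`, `j₂ ≫ τ = υ ≫ j`, `J·𝒪_{F₁} = 𝔪_x`),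
  for a nose `K` at `p = j x` whose frame and quadratic part stay a nose downstairs: `(St_τ K)·𝒪_{F₂} = St_υ(K·𝒪_{F₁})`.

References: [cite: StacksProject, Tag 0804] [cite: GortzWedhorn2020, (13.19), Prop. 13.91].
-/

set_option linter.dupNamespace false

noncomputable section

open CategoryTheory CategoryTheory.Limits AlgebraicGeometry TopologicalSpace Topology IsLocalRing
open Literature.AlgebraicGeometry.Resolution
open AlgebraicGeometry.Scheme.IdealSheafData
open Summit.ResolutionOfSingularities.ResolutionOfSingularities.Cruxes.EquisingularLift.StrataSplit

namespace Summit.ResolutionOfSingularities.ResolutionOfSingularities.Cruxes.EquisingularLiftNat.Sections.Equinodal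

open Summit.ResolutionOfSingularities.ResolutionOfSingularities.Cruxes.EquisingularLiftNat.Sections

universe u

section Stalks

variable {X X' : Scheme.{u}} {τ : X' ⟶ X} {J : X.IdealSheafData}

set_option maxHeartbeats 400000 in -- the chart algebra `blowupAlgebra` is a subalgebra of a localisation: slow instance unification (as p509910)
/-- **THE NOSE STALK THEOREM (x'-form).** For a blow-up `τ : X' → X` along `J`, `X'` locally Noetherian, `x'` with `τ x' ∈ supp J`, a
quasi-regular frame `c` of `J_{τ x'}` with `𝒪/(c)` a domain, and `K_{τ x'} = (c_{i₀}, Φ₂(c) + Ψ₃(c))` a NOSE (forms of degrees `2`, `3`, the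
reduced dehomogenisations of `Φ₂` off the `i₀`-chart not divisible by `T_{i₀}`): on the chart `j` of `x'` with chart map `χ` one has
`E_{x'} = (χ(c_j/1))`, `c_j/1 ∈ 𝔔`, and `St_τ(K)_{x'} = (χ(c_{i₀}/c_j), χ(Φ₂(c/c_j) + (c_j/1)Ψ₃(c/c_j)))`. [cite: StacksProject, Tag 0804] -/
theorem exists_stalk_strictTransformIdeal_nose [IsLocallyNoetherian X'] (hτ : IsBlowup τ J)
    (K : X.IdealSheafData) (x' : X') (hx' : τ x' ∈ (J.support : Set X)) {r : ℕ}
    (c : Fin r → X.presheaf.stalk (τ x')) (hcJ : Ideal.span (Set.range c) = stalkIdeal J (τ x'))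
    (hc : IsQuasiRegular c) [IsDomain (X.presheaf.stalk (τ x') ⧸ Ideal.span (Set.range c))]
    (i₀ : Fin r) (Φ₂ Ψ₃ : MvPolynomial (Fin r) (X.presheaf.stalk (τ x')))
    (hΦ₂ : Φ₂.IsHomogeneous 2) (hΨ₃ : Ψ₃.IsHomogeneous 3)
    (hΦ₀ : ∀ (i : Fin r) (hne : i₀ ≠ i), MvPolynomial.map (Ideal.Quotient.mk (Ideal.span (Set.range c))) (dehomogenize i Φ₂) ∉
      Ideal.span (MvPolynomial.X '' ({⟨i₀, hne⟩} : Set {j : Fin r // j ≠ i})))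
    (hK : stalkIdeal K (τ x') = Ideal.span {c i₀, MvPolynomial.eval c Φ₂ + MvPolynomial.eval c Ψ₃}) :
    ∃ (j : Fin r) (𝔔 : PrimeSpectrum (blowupAlgebra (Ideal.span (Set.range c)) (c j)))
      (χ : blowupAlgebra (Ideal.span (Set.range c)) (c j) →+* X'.presheaf.stalk x')
      (e : X'.presheaf.stalk x' ≃+* Localization.AtPrime 𝔔.asIdeal),
      (∀ a, χ (algebraMap _ _ a) = (τ.stalkMap x').hom a) ∧
      (∀ b, e (χ b) = algebraMap _ (Localization.AtPrime 𝔔.asIdeal) b) ∧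
      𝔔.asIdeal.comap (algebraMap _ (blowupAlgebra (Ideal.span (Set.range c)) (c j))) =
        maximalIdeal (X.presheaf.stalk (τ x')) ∧
      algebraMap _ (blowupAlgebra (Ideal.span (Set.range c)) (c j)) (c j) ∈ 𝔔.asIdeal ∧
      stalkIdeal (J.comap τ) x' =
        Ideal.span {χ (algebraMap _ (blowupAlgebra (Ideal.span (Set.range c)) (c j)) (c j))} ∧
      stalkIdeal (strictTransformIdeal τ J K) x' =
        Ideal.span {χ (blowupAlgebra.frac c j i₀),
          χ (MvPolynomial.aeval (blowupAlgebra.frac c j) Φ₂ +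
            algebraMap _ (blowupAlgebra (Ideal.span (Set.range c)) (c j)) (c j) *
              MvPolynomial.aeval (blowupAlgebra.frac c j) Ψ₃)} := by
  obtain ⟨j, 𝔔, χ, e, hχ, he, h𝔔⟩ :=
    exists_blowupAlgebra_stalk_ringEquiv_of_eq hτ x' c (Ideal.span (Set.range c)) rfl hcJ
  letI := χ.toAlgebra
  haveI : IsLocalization.AtPrime (X'.presheaf.stalk x') 𝔔.asIdeal := isLocalization_stalk_of_ringEquiv 𝔔 x' χ e he
  have hstalkMap : (τ.stalkMap x').hom =
      χ.comp (algebraMap _ (blowupAlgebra (Ideal.span (Set.range c)) (c j))) :=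
    RingHom.ext fun a => (hχ a).symm
  -- the stalk of the exceptional ideal
  have hE : stalkIdeal (J.comap τ) x' =
      Ideal.span {χ (algebraMap _ (blowupAlgebra (Ideal.span (Set.range c)) (c j)) (c j))} := by
    rw [stalkIdeal_comap_eq_map_stalkMap, ← hcJ, hstalkMap, ← Ideal.map_map,
      map_blowupAlgebra_eq_span (Ideal.subset_span (Set.mem_range_self j)), Ideal.map_span, Set.image_singleton]
  -- `c_j/1 ∈ 𝔔` over `supp J`
  have ht𝔔 : algebraMap _ (blowupAlgebra (Ideal.span (Set.range c)) (c j)) (c j) ∈ 𝔔.asIdeal := by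
    rw [← Ideal.mem_comap, h𝔔]
    have h := (mem_support_iff_stalkIdeal_le J (τ x')).mp hx'
    rw [← hcJ] at h
    exact h (Ideal.subset_span (Set.mem_range_self j))
  -- the stalk of the strict transform: the saturation, computed by the NOSE CHART theorem in the localisation `𝒪_{X',x'}`
  have hSt : stalkIdeal (strictTransformIdeal τ J K) x' =
      Ideal.span {χ (blowupAlgebra.frac c j i₀),
        χ (MvPolynomial.aeval (blowupAlgebra.frac c j) Φ₂ +
          algebraMap _ (blowupAlgebra (Ideal.span (Set.range c)) (c j)) (c j) *
            MvPolynomial.aeval (blowupAlgebra.frac c j) Ψ₃)} := by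
    rw [stalkIdeal_strictTransformIdeal, hE, hK, Ideal.map_span, Set.image_pair, hstalkMap]
    exact NoseChart.iSup_colon_nose_eq_span_localization c j i₀ hc hΦ₂ hΨ₃ (hΦ₀ j) 𝔔.asIdeal ht𝔔
      (X'.presheaf.stalk x')
  exact ⟨j, 𝔔, χ, e, hχ, he, h𝔔, ht𝔔, hE, hSt⟩

set_option maxHeartbeats 400000 in -- as above
/-- **p-form** of the nose stalk theorem: the same at a NAMED point `p` with `τ x' = p` (the chart map extends `τ^♯` composed with
`𝒪_{X,p} ≅ 𝒪_{X,τ x'}`). [cite: StacksProject, Tag 0804] -/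
theorem exists_stalk_strictTransformIdeal_nose_of_eq [IsLocallyNoetherian X'] (hτ : IsBlowup τ J)
    (K : X.IdealSheafData) (x' : X') (p : X) (hp : τ x' = p) (hpJ : p ∈ (J.support : Set X)) {r : ℕ}
    (c : Fin r → X.presheaf.stalk p) (hcJ : Ideal.span (Set.range c) = stalkIdeal J p)
    (hc : IsQuasiRegular c) [IsDomain (X.presheaf.stalk p ⧸ Ideal.span (Set.range c))]
    (i₀ : Fin r) (Φ₂ Ψ₃ : MvPolynomial (Fin r) (X.presheaf.stalk p))
    (hΦ₂ : Φ₂.IsHomogeneous 2) (hΨ₃ : Ψ₃.IsHomogeneous 3)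
    (hΦ₀ : ∀ (i : Fin r) (hne : i₀ ≠ i), MvPolynomial.map (Ideal.Quotient.mk (Ideal.span (Set.range c))) (dehomogenize i Φ₂) ∉
      Ideal.span (MvPolynomial.X '' ({⟨i₀, hne⟩} : Set {j : Fin r // j ≠ i})))
    (hK : stalkIdeal K p = Ideal.span {c i₀, MvPolynomial.eval c Φ₂ + MvPolynomial.eval c Ψ₃}) :
    ∃ (j : Fin r) (χ : blowupAlgebra (Ideal.span (Set.range c)) (c j) →+* X'.presheaf.stalk x'),
      (∀ a, χ (algebraMap _ _ a) = (τ.stalkMap x').hom ((X.presheaf.stalkCongr (Inseparable.of_eq hp)).inv a)) ∧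
      stalkIdeal (J.comap τ) x' =
        Ideal.span {χ (algebraMap _ (blowupAlgebra (Ideal.span (Set.range c)) (c j)) (c j))} ∧
      stalkIdeal (strictTransformIdeal τ J K) x' =
        Ideal.span {χ (blowupAlgebra.frac c j i₀),
          χ (MvPolynomial.aeval (blowupAlgebra.frac c j) Φ₂ +
            algebraMap _ (blowupAlgebra (Ideal.span (Set.range c)) (c j)) (c j) *
              MvPolynomial.aeval (blowupAlgebra.frac c j) Ψ₃)} := by
  subst hp
  obtain ⟨j, 𝔔, χ, e, hχ, -, -, -, hE, hSt⟩ :=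
    exists_stalk_strictTransformIdeal_nose hτ K x' hpJ c hcJ hc i₀ Φ₂ Ψ₃ hΦ₂ hΨ₃ hΦ₀ hK
  refine ⟨j, χ, fun a => ?_, hE, hSt⟩
  rw [hχ]
  simp [TopCat.Presheaf.stalkCongr]

end Stalks

/-- `(u a, u² b) = (a, b)` for a unit `u`. [folklore] -/
theorem span_pair_unit_mul_eq {A : Type u} [CommRing A] (u : Aˣ) (a b : A) :
    Ideal.span {(u : A) * a, (u : A) ^ 2 * b} = Ideal.span {a, b} := by
  rw [Ideal.span_insert, Ideal.span_insert, Ideal.span_singleton_mul_left_unit u.isUnit,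
    Ideal.span_singleton_mul_left_unit (u.isUnit.pow 2)]

/-! ## (F⁺5ⁿ): the special fibre of the strict transform of a NOSE -/

set_option maxHeartbeats 1600000 in -- two instances of the chart-algebra stalk theorem plus stalk transport (as F⁺5, p-file …NatStrictTransformComap)
/-- ★ **(F⁺5ⁿ) «the special fibre of the strict transform of a NOSE is the strict transform of its special fibre».** In the model square
(`τ = Bl_J`, `υ = Bl_x`, `j₂ ≫ τ = υ ≫ j`, `J·𝒪_{F₁} = 𝔪_x`), for an ideal sheaf `K` whose stalk at `p = j x` is a NOSE
`(c_{i₀}, Φ₂(c) + Ψ₃(c))` on a quasi-regular frame `c` of `J_p` (`𝒪/(c)` a domain), such that the downstairs frame `c̄ = j^♯ ∘ c` is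
quasi-regular and the reduced dehomogenisations of `Φ₂` (upstairs) and of `Φ̄₂` (downstairs) off the `i₀`-chart avoid `T_{i₀}`:
`(St_τ K)·𝒪_{F₂} = St_υ(K·𝒪_{F₁})`. Proof: stalkwise on `F₂`; over `x` both stalks are read on the chart algebras by the NOSE STALK
theorem and compared in `𝒪_{F₂,y}` exactly as in F⁺5 (`(t) = (t̄)`, unit rescale `q̄ = u q`, `ḡ′ = u² g′`); off `x` both are total
transforms. [cite: StacksProject, Tag 0804] [cite: GortzWedhorn2020, (13.19), Prop. 13.91] [OURS · L1 W4.5b · HNODE P6 (F⁺5ⁿ)] -/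
theorem comap_strictTransformIdeal_eq_of_model_nose {X' X₁ F₁ F₂ : Scheme.{0}} (τ : X₁ ⟶ X')
    (J K : X'.IdealSheafData) (hτ : IsBlowup τ J) [IsLocallyNoetherian X₁] [IsLocallyNoetherian F₂]
    [IsIntegral F₁] [IsIntegral F₂] [IsLocallyNoetherian F₁]
    (j : F₁ ⟶ X') (υ : F₂ ⟶ F₁) (j₂ : F₂ ⟶ X₁) (hcomm : j₂ ≫ τ = υ ≫ j)
    (x : F₁) (hx : IsClosed ({x} : Set F₁))
    (hυ : IsBlowup υ (vanishingIdeal ⟨{x}, hx⟩)) (hJ : J.comap j = vanishingIdeal ⟨{x}, hx⟩)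
    -- the nose data at `j x`
    {r : ℕ} (c : Fin r → X'.presheaf.stalk (j x)) (hcJ : Ideal.span (Set.range c) = stalkIdeal J (j x))
    (hc : IsQuasiRegular c) [IsDomain (X'.presheaf.stalk (j x) ⧸ Ideal.span (Set.range c))]
    (i₀ : Fin r) (Φ₂ Ψ₃ : MvPolynomial (Fin r) (X'.presheaf.stalk (j x)))
    (hΦ₂ : Φ₂.IsHomogeneous 2) (hΨ₃ : Ψ₃.IsHomogeneous 3)
    (hΦ₀ : ∀ (i : Fin r) (hne : i₀ ≠ i), MvPolynomial.map (Ideal.Quotient.mk (Ideal.span (Set.range c))) (dehomogenize i Φ₂) ∉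
      Ideal.span (MvPolynomial.X '' ({⟨i₀, hne⟩} : Set {j : Fin r // j ≠ i})))
    (hK : stalkIdeal K (j x) = Ideal.span {c i₀, MvPolynomial.eval c Φ₂ + MvPolynomial.eval c Ψ₃})
    -- its image downstairs
    (hcbar : IsQuasiRegular (fun i => (j.stalkMap x).hom (c i)))
    (hΦbar : ∀ (i : Fin r) (hne : i₀ ≠ i),
      MvPolynomial.map (Ideal.Quotient.mk (Ideal.span (Set.range fun i => (j.stalkMap x).hom (c i))))
        (dehomogenize i (MvPolynomial.map (j.stalkMap x).hom Φ₂)) ∉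
      Ideal.span (MvPolynomial.X '' ({⟨i₀, hne⟩} : Set {j : Fin r // j ≠ i}))) :
    (strictTransformIdeal τ J K).comap j₂ = strictTransformIdeal υ (vanishingIdeal ⟨{x}, hx⟩) (K.comap j) := by
  classical
  -- adapted from `comap_strictTransformIdeal_eq_of_model` (…NatStrictTransformComap, this seat g16)
  have hE : (J.comap τ).comap j₂ = (vanishingIdeal ⟨{x}, hx⟩ : F₁.IdealSheafData).comap υ := by
    rw [← hJ, ← Scheme.IdealSheafData.comap_comp, ← Scheme.IdealSheafData.comap_comp, hcomm]
  refine ext_of_forall_stalkIdeal_eq fun y => ?_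
  by_cases hy : υ y = x
  · subst hy
    have hτx' : τ (j₂ y) = j (υ y) := by
      rw [← Scheme.Hom.comp_apply, hcomm, Scheme.Hom.comp_apply]
    have hxJ : j (υ y) ∈ (J.support : Set X') := by
      have : υ y ∈ ((J.comap j).support : Set F₁) := by
        rw [hJ, Scheme.IdealSheafData.coe_support_vanishingIdeal]; rfl
      rw [Scheme.IdealSheafData.support_comap] at this
      exact this
    -- the downstairs nose data
    set cb : Fin r → F₁.presheaf.stalk (υ y) := fun i => (j.stalkMap (υ y)).hom (c i) with hcb
    set Φb : MvPolynomial (Fin r) (F₁.presheaf.stalk (υ y)) := MvPolynomial.map (j.stalkMap (υ y)).hom Φ₂ with hΦb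
    set Ψb : MvPolynomial (Fin r) (F₁.presheaf.stalk (υ y)) := MvPolynomial.map (j.stalkMap (υ y)).hom Ψ₃ with hΨb
    have hrange : Set.range cb = (j.stalkMap (υ y)).hom '' Set.range c := by
      rw [hcb]; exact Set.range_comp _ _
    have hcbJ : Ideal.span (Set.range cb) = stalkIdeal (vanishingIdeal ⟨{υ y}, hx⟩ : F₁.IdealSheafData) (υ y) := by
      rw [← hJ, stalkIdeal_comap_eq_map_stalkMap, ← hcJ, Ideal.map_span, hrange]
    have hcb𝔪 : Ideal.span (Set.range cb) = maximalIdeal (F₁.presheaf.stalk (υ y)) := by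
      rw [hcbJ, stalkIdeal_vanishingIdeal_singleton hx]
    haveI : IsDomain (F₁.presheaf.stalk (υ y) ⧸ Ideal.span (Set.range cb)) :=
      isDomain_quotient_span_of_span_eq_maximalIdeal hcb𝔪
    have hΦbd : Φb.IsHomogeneous 2 := hΦ₂.map _
    have hΨbd : Ψb.IsHomogeneous 3 := hΨ₃.map _
    have hevalb : ∀ Φ : MvPolynomial (Fin r) (X'.presheaf.stalk (j (υ y))),
        (j.stalkMap (υ y)).hom (MvPolynomial.eval c Φ) = MvPolynomial.eval cb (MvPolynomial.map (j.stalkMap (υ y)).hom Φ) := by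
      intro Φ
      rw [MvPolynomial.eval_map, show MvPolynomial.eval c Φ = MvPolynomial.eval₂ (RingHom.id _) c Φ from rfl,
        MvPolynomial.eval₂_comp_left, RingHom.comp_id]
      rfl
    have hKb : stalkIdeal (K.comap j) (υ y) = Ideal.span {cb i₀, MvPolynomial.eval cb Φb + MvPolynomial.eval cb Ψb} := by
      rw [stalkIdeal_comap_eq_map_stalkMap, hK, Ideal.map_span, Set.image_pair, map_add, hevalb, hevalb]
    have hyJ : υ y ∈ ((vanishingIdeal ⟨{υ y}, hx⟩ : F₁.IdealSheafData).support : Set F₁) := by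
      rw [Scheme.IdealSheafData.coe_support_vanishingIdeal]; rfl
    -- the two stalk presentations
    obtain ⟨jj, χ, hχ, hEu, hStu⟩ :=
      exists_stalk_strictTransformIdeal_nose_of_eq hτ K (j₂ y) (j (υ y)) hτx' hxJ c hcJ hc i₀ Φ₂ Ψ₃ hΦ₂ hΨ₃ hΦ₀ hK
    obtain ⟨j', 𝔔', χ', e', hχ', -, -, -, hEd, hStd⟩ :=
      exists_stalk_strictTransformIdeal_nose hυ (K.comap j) y hyJ cb hcbJ hcbar i₀ Φb Ψb hΦbd hΨbd hΦbar hKb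
    -- everything in `A = 𝒪_{F₂,y}`
    set ψ : blowupAlgebra (Ideal.span (Set.range c)) (c jj) →+* F₂.presheaf.stalk y := (j₂.stalkMap y).hom.comp χ with hψ
    set t : F₂.presheaf.stalk y := ψ (algebraMap _ _ (c jj)) with ht
    set t' : F₂.presheaf.stalk y := χ' (algebraMap _ _ (cb j')) with ht'
    set q : Fin r → F₂.presheaf.stalk y := fun l => ψ (blowupAlgebra.frac c jj l) with hq
    set q' : Fin r → F₂.presheaf.stalk y := fun l => χ' (blowupAlgebra.frac cb j' l) with hq'
    -- the coefficient maps agree: `ψ ∘ alg = υ^♯ ∘ j^♯ = χ' ∘ alg ∘ j^♯`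
    have hcoef : ∀ a : X'.presheaf.stalk (j (υ y)),
        ψ (algebraMap _ _ a) = (υ.stalkMap y).hom ((j.stalkMap (υ y)).hom a) := by
      intro a
      rw [hψ, RingHom.comp_apply, hχ]
      have h1 : (j₂ ≫ τ).stalkMap y = (X'.presheaf.stalkCongr (.of_eq (by rw [hcomm]))).hom ≫ (υ ≫ j).stalkMap y :=
        Scheme.Hom.stalkMap_congr_hom _ _ hcomm y
      have h2 : ∀ z, (j₂.stalkMap y).hom ((τ.stalkMap (j₂ y)).hom z) = ((j₂ ≫ τ).stalkMap y).hom z := fun z => by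
        rw [Scheme.Hom.stalkMap_comp]; rfl
      have h3 : ((X'.presheaf.stalkCongr (.of_eq (by rw [hcomm]) : Inseparable ((j₂ ≫ τ) y) ((υ ≫ j) y))).hom)
          ((X'.presheaf.stalkCongr (Inseparable.of_eq hτx')).inv a) = a := by
        change ((X'.presheaf.stalkCongr (Inseparable.of_eq hτx')).inv ≫
          (X'.presheaf.stalkCongr (Inseparable.of_eq hτx')).hom) a = a
        rw [Iso.inv_hom_id]; rfl
      have h4 : ∀ b, ((υ ≫ j).stalkMap y).hom b = (υ.stalkMap y).hom ((j.stalkMap (υ y)).hom b) := fun b => by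
        rw [Scheme.Hom.stalkMap_comp]; rfl
      rw [h2, h1, CommRingCat.hom_comp, RingHom.comp_apply, ← h4]
      exact congrArg _ h3
    have hcoef' : ∀ a : X'.presheaf.stalk (j (υ y)),
        χ' (algebraMap _ _ ((j.stalkMap (υ y)).hom a)) = (υ.stalkMap y).hom ((j.stalkMap (υ y)).hom a) :=
      fun a => hχ' _
    -- `a_l = q_l * t = q'_l * t'`
    have hqt : ∀ l, q l * t = (υ.stalkMap y).hom ((j.stalkMap (υ y)).hom (c l)) := by
      intro l
      rw [hq, ht, ← map_mul, mul_comm, blowupAlgebra.algebraMap_mul_gen, hcoef]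
    have hqt' : ∀ l, q' l * t' = (υ.stalkMap y).hom ((j.stalkMap (υ y)).hom (c l)) := by
      intro l
      rw [hq', ht', ← map_mul, mul_comm, blowupAlgebra.algebraMap_mul_gen, hcoef']
    -- `(t) = (t') = E₂_y`, so `t = u * t'` with `u` a unit
    have hspan : Ideal.span {t} = Ideal.span {t'} := by
      have h1 : stalkIdeal ((vanishingIdeal ⟨{υ y}, hx⟩ : F₁.IdealSheafData).comap υ) y = Ideal.span {t} := by
        rw [← hE, stalkIdeal_comap_eq_map_stalkMap, hEu, Ideal.map_span, Set.image_singleton]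
        rfl
      rw [← h1, hEd]
    obtain ⟨u, hu⟩ : Associated t' t := (Ideal.span_singleton_eq_span_singleton.mp hspan).symm
    -- `t' ≠ 0`: a member of the quasi-regular `cb`, transported by the injective `υ^♯_y`
    have ht'0 : t' ≠ 0 := by
      rw [ht', hχ']
      intro h0
      have h1 : cb j' = 0 := hυ.stalkMap_injective y (h0.trans (map_zero _).symm)
      exact ne_zero_of_isQuasiRegular hcbar (by rw [hcb𝔪]; exact (maximalIdeal.isMaximal _).ne_top) j' h1
    -- `q' = u • q`
    have hqq : q' = (u : F₂.presheaf.stalk y) • q := by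
      funext l
      have h1 : q' l * t' = ((u : F₂.presheaf.stalk y) * q l) * t' := by
        rw [hqt', ← hqt l, ← hu]; ring
      simp only [Pi.smul_apply, smul_eq_mul]
      exact mul_right_cancel₀ ht'0 h1
    -- the two forms, evaluated
    set P₂ : MvPolynomial (Fin r) (F₂.presheaf.stalk y) :=
      MvPolynomial.map ((υ.stalkMap y).hom.comp (j.stalkMap (υ y)).hom) Φ₂ with hP₂
    set P₃ : MvPolynomial (Fin r) (F₂.presheaf.stalk y) :=
      MvPolynomial.map ((υ.stalkMap y).hom.comp (j.stalkMap (υ y)).hom) Ψ₃ with hP₃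
    have hP₂d : P₂.IsHomogeneous 2 := hΦ₂.map _
    have hP₃d : P₃.IsHomogeneous 3 := hΨ₃.map _
    have hψalg : ψ.comp (algebraMap _ (blowupAlgebra (Ideal.span (Set.range c)) (c jj))) =
        (υ.stalkMap y).hom.comp (j.stalkMap (υ y)).hom := RingHom.ext fun a => hcoef a
    have hχ'alg : (χ'.comp (algebraMap _ (blowupAlgebra (Ideal.span (Set.range cb)) (cb j')))).comp
        (j.stalkMap (υ y)).hom = (υ.stalkMap y).hom.comp (j.stalkMap (υ y)).hom := RingHom.ext fun a => hcoef' a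
    have hup : ∀ (Φ : MvPolynomial (Fin r) (X'.presheaf.stalk (j (υ y)))),
        ψ (MvPolynomial.aeval (blowupAlgebra.frac c jj) Φ) =
          MvPolynomial.eval q (MvPolynomial.map ((υ.stalkMap y).hom.comp (j.stalkMap (υ y)).hom) Φ) := by
      intro Φ
      rw [MvPolynomial.aeval_def, MvPolynomial.eval₂_comp_left, hψalg, MvPolynomial.eval_map]
      rfl
    have hdown : ∀ (Φ : MvPolynomial (Fin r) (X'.presheaf.stalk (j (υ y)))) (d : ℕ), Φ.IsHomogeneous d →
        χ' (MvPolynomial.aeval (blowupAlgebra.frac cb j') (MvPolynomial.map (j.stalkMap (υ y)).hom Φ)) =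
          (u : F₂.presheaf.stalk y) ^ d *
            MvPolynomial.eval q (MvPolynomial.map ((υ.stalkMap y).hom.comp (j.stalkMap (υ y)).hom) Φ) := by
      intro Φ d hΦd
      have hPd : (MvPolynomial.map ((υ.stalkMap y).hom.comp (j.stalkMap (υ y)).hom) Φ).IsHomogeneous d := hΦd.map _
      rw [MvPolynomial.aeval_def, MvPolynomial.eval₂_comp_left, MvPolynomial.eval₂_map, hχ'alg,
        ← MvPolynomial.eval_map, ← eval_smul_of_isHomogeneous' hPd, ← hqq]
      rfl
    -- the generators upstairs and downstairs, in `𝒪_{F₂,y}`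
    have hL : ψ (MvPolynomial.aeval (blowupAlgebra.frac c jj) Φ₂ +
        algebraMap _ (blowupAlgebra (Ideal.span (Set.range c)) (c jj)) (c jj) * MvPolynomial.aeval (blowupAlgebra.frac c jj) Ψ₃) =
        MvPolynomial.eval q P₂ + t * MvPolynomial.eval q P₃ := by
      rw [map_add, map_mul, hup, hup, hP₂, hP₃, ht]
    have hR : χ' (MvPolynomial.aeval (blowupAlgebra.frac cb j') Φb +
        algebraMap _ (blowupAlgebra (Ideal.span (Set.range cb)) (cb j')) (cb j') * MvPolynomial.aeval (blowupAlgebra.frac cb j') Ψb) =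
        (u : F₂.presheaf.stalk y) ^ 2 * (MvPolynomial.eval q P₂ + t * MvPolynomial.eval q P₃) := by
      rw [map_add, map_mul, hΦb, hΨb, hdown Φ₂ 2 hΦ₂, hdown Ψ₃ 3 hΨ₃, ← hP₂, ← hP₃, ← ht', ← hu]
      ring
    have hRe : χ' (blowupAlgebra.frac cb j' i₀) = (u : F₂.presheaf.stalk y) * q i₀ := by
      change q' i₀ = _
      rw [hqq, Pi.smul_apply, smul_eq_mul]
    -- conclude at `y`
    rw [stalkIdeal_comap_eq_map_stalkMap, hStu, Ideal.map_span, Set.image_pair, hStd]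
    change Ideal.span {ψ _, ψ _} = Ideal.span {χ' _, χ' _}
    rw [hL, hR, hRe, span_pair_unit_mul_eq]
  · -- off the exceptional locus both sides are the total transform `(K · 𝒪_{F₁}) · 𝒪_{F₂} = (K · 𝒪_{X₁}) · 𝒪_{F₂}`
    have hyE : y ∉ ((vanishingIdeal ⟨{x}, hx⟩ : F₁.IdealSheafData).comap υ).support := by
      intro h
      have h' : y ∈ (((vanishingIdeal ⟨{x}, hx⟩ : F₁.IdealSheafData).comap υ).support : Set F₂) := h
      rw [Scheme.IdealSheafData.support_comap, TopologicalSpace.Closeds.coe_preimage,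
        Scheme.IdealSheafData.coe_support_vanishingIdeal] at h'
      exact hy h'
    have hyE' : j₂ y ∉ (J.comap τ).support := by
      intro h
      apply hyE
      have h' : y ∈ (((J.comap τ).comap j₂).support : Set F₂) := by
        rw [Scheme.IdealSheafData.support_comap]
        exact h
      rw [hE] at h'
      exact h'
    have hR : stalkIdeal (strictTransformIdeal υ (vanishingIdeal ⟨{x}, hx⟩) (K.comap j)) y =
        stalkIdeal ((K.comap j).comap υ) y := by
      rw [stalkIdeal_strictTransformIdeal_of_not_mem _ _ (K.comap j) hyE, ← stalkIdeal_comap_eq_map_stalkMap]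
    have hL : stalkIdeal ((strictTransformIdeal τ J K).comap j₂) y = stalkIdeal ((K.comap τ).comap j₂) y := by
      rw [stalkIdeal_comap_eq_map_stalkMap, stalkIdeal_strictTransformIdeal_of_not_mem _ _ K hyE',
        ← stalkIdeal_comap_eq_map_stalkMap, ← stalkIdeal_comap_eq_map_stalkMap]
    rw [hL, hR, ← Scheme.IdealSheafData.comap_comp, ← Scheme.IdealSheafData.comap_comp, hcomm]

end Summit.ResolutionOfSingularities.ResolutionOfSingularities.Cruxes.EquisingularLiftNat.Sections.Equinodal

end
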